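import Summits.HubbardSuperconductivity.HubbardSuperconductivity.Theorems.InfiniteVolumeFirstNoNormalLimitStateReductions
import Summits.HubbardSuperconductivity.HubbardSuperconductivity.Theorems.CwSsbToEvenTorusLRO.Negative.RepelledOrderCeiling
import Summits.HubbardSuperconductivity.HubbardSuperconductivity.Theorems.NoGoNogoThesis
import Literature.MathematicalPhysics.QuantumLattice.GroundStateSourceBounds
import Literature.MathematicalPhysics.QuantumLattice.DWaveSourceProofs
import Literature.MathematicalPhysics.QuantumLattice.HubbardModelParticleHoleProofs
import Literature.MathematicalPhysics.QuantumLattice.SectorSpectrum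
import Literature.MathematicalPhysics.QuantumLattice.BdGBondHamiltonianTorus
import HarnessLib

/-!
# Crux `NoNormalLimitState` (stmt-HubbardSuperconductivity-18533), idea `sourced-penalty-trial-state`:
# the penalised, sourced ground state as a TRIAL STATE for the Kac-window chord

Route `InfiniteVolumeFirst`, crux r2. The registered hard stub of line `window-gap-transfer` is the chord
`λ a L² ≤ minE_sec(H_U + λ W_ε) − minE_sec(H_U)` (`stub_windowGapCofinal`; it implies the crux by the landed
`noNormalLimitState_of_windowGapCofinal`). Read from the `λ > 0` side, a chord is an UPPER bound on the
unperturbed ground energy, i.e. a trial-state inequality. This file makes the idea card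
`Cruxes/NoNormalLimitState/Ideas/sourced-penalty-trial-state.md` kernel-checked:

* `re_gsf_sub_le_groundEnergy_add_two_norm` — the ground state of a sourced Hamiltonian `B − S` has
  unsourced energy within `2‖S‖` of `E₀(B)`;
* `penalisedSourceChord` — **abstract penalised Griffiths chord**: for Hermitian `A, W, S` and real `λ`,
  with `ω` the tracial ground state of `A + λW − S`, `λ · Re ω(W) − 2‖S‖ ≤ E₀(A + λW) − E₀(A)`;
* `groundEnergy_le_minEnergyOn_sector_sub` — **sector floor**: `E₀(H − μN + X) ≤ minE_{(N,M)}(H + X) − μN`;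
* `isHermitian_windowOp`, `sq_re_gsf_pairField_le_windowOp` — the Kac window operator
  `W_ε = Σ_{|q_m| ≤ ε} L⁻² Δ_d(m)ᴴ Δ_d(m)` is Hermitian and dominates the squared order parameter in every
  tracial ground state: `(Re ω(Δ_d))² ≤ L² · Re ω(W_ε)`;
* `stub_sourcedChord` — the card's FIRST LEMMA: for the grand-canonical torus `A = H_U − μN`, every `ε`, `λ ≥ 0`,
  `h ≥ 0` and `m := Re ω(Δ_d)/L²` the tracial `d`-wave density of the ground state of
  `A − h(Δ_d + Δ_dᴴ) + λ W_ε`: `λ L² m² − 24 h L² ≤ E₀(A + λW_ε) − E₀(A)`;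
* the COMPOSITION (a Koma–Tasaki floor on the penalised sourced density of ONE grand-canonical family plus
  zero-temperature ensemble equivalence ⇒ the chord ⇒ the crux) is the sequel file
  `InfiniteVolumeFirstNoNormalLimitStateSourcedPenaltyTransfer.lean`.

Folklore finite-dimensional variational bookkeeping (Tasaki 2020 §2.1; Koma–Tasaki, J. Stat. Phys. 76
(1994) 745, §1). No new definitions; no named facts.
-/

noncomputable section

set_option linter.dupNamespace false

namespace Summit.HubbardSuperconductivity.HubbardSuperconductivity.Theorems.NoNormalLimitState

open Literature.MathematicalPhysics.QuantumLattice Literature.Probability.LatticeModels Matrix Finset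
  Filter
open Summit.HubbardSuperconductivity.HubbardSuperconductivity.Theses
open Summit.HubbardSuperconductivity.HubbardSuperconductivity.Theorems.CwSsbToEvenTorusLRO.Negative
  (sq_re_groundStateFunctional_le re_groundStateFunctional_mono isHermitian_add_real_smul)
open scoped ComplexConjugate ComplexOrder Topology Matrix.Norms.L2Operator

/-! ### 1. Abstract penalised Griffiths chord -/

section Abstract

variable {n : Type*} [Fintype n] [DecidableEq n] [Nonempty n]

/-- **The ground state of a sourced Hamiltonian nearly minimises the unsourced one**: for Hermitian `B`, `S`
and `ω` the tracial ground state of `B − S`, `Re ω(B) ≤ E₀(B) + 2‖S‖`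
(`ω(B) = E₀(B − S) + Re ω(S)`, `E₀(B − S) ≤ E₀(B) + ‖S‖` by the variational principle with the ground state
of `B`, and `|Re ω(S)| ≤ ‖S‖`). Tasaki (2020) §2.1. [folklore] -/
theorem re_gsf_sub_le_groundEnergy_add_two_norm {B S : Matrix n n ℂ} (hB : B.IsHermitian)
    (hS : S.IsHermitian) :
    ((B - S).groundStateFunctional B).re ≤ B.groundEnergy + 2 * ‖S‖ := by
  have hK : (B - S).IsHermitian := hB.sub hS
  have h1 : ((B - S).groundStateFunctional B).re =
      (B - S).groundEnergy + ((B - S).groundStateFunctional S).re := by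
    have e : (B - S).groundStateFunctional B = (B - S).groundStateFunctional ((B - S) + S) := by
      rw [sub_add_cancel]
    rw [e, map_add, Complex.add_re, groundStateFunctional_hamiltonian hK, Complex.ofReal_re]
  have h2 := groundEnergy_le_groundStateFunctional_re hB hK
  rw [map_sub, Complex.sub_re, groundStateFunctional_hamiltonian hB, Complex.ofReal_re] at h2
  have h3 := (abs_le.mp (abs_re_groundStateFunctional_le_norm hB S)).1
  have h4 := (abs_le.mp (abs_re_groundStateFunctional_le_norm hK S)).2
  linarith

/-- **Abstract penalised Griffiths chord (sourced, penalised ground state as a trial state).** For Hermitian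
`A` (Hamiltonian), `W` (penalty), `S` (source) and real `λ`, with `ω` the tracial ground state of
`A + λW − S`: `λ · Re ω(W) − 2‖S‖ ≤ E₀(A + λW) − E₀(A)` — `E₀(A) ≤ Re ω(A) = Re ω(A + λW) − λ Re ω(W)` and
`Re ω(A + λW) ≤ E₀(A + λW) + 2‖S‖`. Koma–Tasaki, J. Stat. Phys. 76 (1994) 745, §1; Tasaki (2020) §2.1.
[folklore] -/
theorem penalisedSourceChord {A W S : Matrix n n ℂ} (hA : A.IsHermitian) (hW : W.IsHermitian)
    (hS : S.IsHermitian) (lam : ℝ) :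
    lam * ((A + (lam : ℂ) • W - S).groundStateFunctional W).re - 2 * ‖S‖ ≤
      (A + (lam : ℂ) • W).groundEnergy - A.groundEnergy := by
  have hB : (A + (lam : ℂ) • W).IsHermitian := isHermitian_add_real_smul hA hW lam
  have hK : (A + (lam : ℂ) • W - S).IsHermitian := hB.sub hS
  have h1 := re_gsf_sub_le_groundEnergy_add_two_norm hB hS
  have h2 := groundEnergy_le_groundStateFunctional_re hK hA
  have h3 : ((A + (lam : ℂ) • W - S).groundStateFunctional A).re =
      ((A + (lam : ℂ) • W - S).groundStateFunctional (A + (lam : ℂ) • W)).re -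
        lam * ((A + (lam : ℂ) • W - S).groundStateFunctional W).re := by
    rw [map_add, LinearMap.map_smul, Complex.add_re, smul_eq_mul, Complex.re_ofReal_mul]
    ring
  linarith

end Abstract

/-! ### 2. Sector floor: the grand-canonical ground energy is below every canonical sector energy -/

section Sector

-- `[DecidableEq Λ]` is taken as an argument (rather than derived from the linear order) so that at a concrete
-- lattice the statement is written with the instances found there (no instance diamond for consumers).
variable {Λ : Type*} [LinearOrder Λ] [Fintype Λ] [DecidableEq Λ]

/-- **Sector floor.** For `A = H − μN + X` Hermitian and a non-empty sector `(N, M)`: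
`E₀(H − μN + X) ≤ minEnergyOn (H + X) (szSector N M) − μN` (unit sector vectors are trial vectors for the
grand-canonical problem and `N̂ = N` on the sector). Tasaki (2020) §2.1–2.2. [folklore] -/
theorem groundEnergy_le_minEnergyOn_sector_sub (H X : Matrix (Finset (Orb Λ)) (Finset (Orb Λ)) ℂ)
    (μ : ℝ) (N : ℕ) (M : ℝ) (hA : (H - (μ : ℂ) • totalNumber + X).IsHermitian)
    (hne : ∃ φ : Fock (Orb Λ), φ ∈ szSector N M ∧ φ ≠ 0) :
    (H - (μ : ℂ) • totalNumber + X).groundEnergy ≤ (H + X).minEnergyOn (szSector N M) - μ * (N : ℝ) := by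
  obtain ⟨φ, hφS, hφ0⟩ := hne
  obtain ⟨c, -, hc1⟩ := exists_smul_unit hφ0
  have hcφS : c • φ ∈ szSector N M := Submodule.smul_mem _ c hφS
  rw [le_sub_iff_add_le]
  refine le_csInf ⟨_, c • φ, hcφS, hc1, rfl⟩ ?_
  rintro E ⟨ψ, hψS, hψ1, rfl⟩
  have hN : (totalNumber : Matrix (Finset (Orb Λ)) (Finset (Orb Λ)) ℂ) *ᵥ ψ = (N : ℂ) • ψ :=
    totalNumber_mulVec_of_isNParticle ((mem_szSector_iff N M ψ).1 hψS).1
  have h := groundEnergy_le_rayleigh_holds hA ψ hψ1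
  have e : star ψ ⬝ᵥ (H - (μ : ℂ) • totalNumber + X) *ᵥ ψ =
      star ψ ⬝ᵥ (H + X) *ᵥ ψ - ((μ * (N : ℝ) : ℝ) : ℂ) := by
    rw [add_mulVec, sub_mulVec, smul_mulVec, hN, smul_smul, add_mulVec, dotProduct_add, dotProduct_sub,
      dotProduct_add, dotProduct_smul, hψ1, smul_eq_mul, mul_one]
    push_cast
    ring
  rw [e, Complex.sub_re, Complex.ofReal_re] at h
  linarith

end Sector

/-! ### 3. The Kac window operator: Hermiticity and domination of the squared order parameter -/

section Window

variable (L : ℕ) [NeZero L]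

/-- The Kac window operator `W_ε = Σ_{|q_m| ≤ ε} L⁻² Δ_d(m)ᴴ Δ_d(m)` (spelled out as in
`stub_windowGapCofinal`) is Hermitian. [folklore] -/
theorem isHermitian_windowOp (ε : ℝ) :
    (∑ m : TorusSite 2 L, if momentumNormSq L m ≤ ε ^ 2 then
        ((L : ℂ) ^ 2)⁻¹ • ((pairFieldAt dWaveFormFactor L m)ᴴ * pairFieldAt dWaveFormFactor L m)
        else 0).IsHermitian := by
  unfold Matrix.IsHermitian
  rw [Matrix.conjTranspose_sum]
  refine Finset.sum_congr rfl fun m _ => ?_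
  split_ifs with hm
  · have hc : star (((L : ℂ) ^ 2)⁻¹) = ((L : ℂ) ^ 2)⁻¹ := by
      rw [Complex.star_def, map_inv₀, map_pow, Complex.conj_natCast]
    rw [Matrix.conjTranspose_smul, Matrix.conjTranspose_mul, Matrix.conjTranspose_conjTranspose, hc]
  · rw [Matrix.conjTranspose_zero]

/-- **Vector-level window domination**: `Re⟨x, Δ_dᴴ Δ_d x⟩ ≤ L² · Re⟨x, W_ε x⟩` for every Fock vector `x` and
every `ε` — the `m = 0` term of the window sum is `S_x(0) = ‖Δ_d x‖²/L²` and the others are non-negative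
(`re_expect_windowPenalty`). Kennedy–Lieb–Shastry, PRL 61 (1988) 2582. [folklore] -/
theorem re_expect_pairField_le_sq_mul_windowOp (ε : ℝ) (x : Fock (Orb (FermionTorus 2 L))) :
    (star x ⬝ᵥ ((pairField dWaveFormFactor L)ᴴ * pairField dWaveFormFactor L) *ᵥ x).re ≤
      (L : ℝ) ^ 2 * (star x ⬝ᵥ (∑ m : TorusSite 2 L, if momentumNormSq L m ≤ ε ^ 2 then
        ((L : ℂ) ^ 2)⁻¹ • ((pairFieldAt dWaveFormFactor L m)ᴴ * pairFieldAt dWaveFormFactor L m)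
        else 0) *ᵥ x).re := by
  rw [re_expect_windowPenalty]
  have hL : (0 : ℝ) < (L : ℝ) ^ 2 := cast_sq_pos_of_neZero L
  have h0 : (star x ⬝ᵥ ((pairField dWaveFormFactor L)ᴴ * pairField dWaveFormFactor L) *ᵥ x).re =
      (L : ℝ) ^ 2 * pairStructureFactor dWaveFormFactor L x 0 := by
    rw [pairStructureFactor_apply, pairFieldAt_zero,
      Literature.MathematicalPhysics.QuantumLattice.star_mulVec_dotProduct_mulVec,
      mul_div_cancel₀ _ hL.ne']
  rw [h0]
  refine mul_le_mul_of_nonneg_left ?_ hL.le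
  have hsingle := Finset.single_le_sum
    (f := fun m : TorusSite 2 L =>
      if momentumNormSq L m ≤ ε ^ 2 then pairStructureFactor dWaveFormFactor L x m else 0)
    (fun m _ => by
      split_ifs
      · exact pairStructureFactor_nonneg dWaveFormFactor L x m
      · exact le_rfl)
    (Finset.mem_univ (0 : TorusSite 2 L))
  have h00 : momentumNormSq L (0 : TorusSite 2 L) ≤ ε ^ 2 := by
    rw [momentumNormSq_zero]; positivity
  simpa only [if_pos h00] using hsingle

/-- **Tracial window domination**: `(Re ω_A(Δ_d))² ≤ L² · Re ω_A(W_ε)` for the tracial ground state of every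
Hermitian `A` and every window radius `ε` (Cauchy–Schwarz `(Re ω(Δ_d))² ≤ Re ω(Δ_dᴴ Δ_d)` for the positive
normalised functional `ω_A`, then positivity of `ω_A` on the operator inequality
`Δ_dᴴ Δ_d ≤ L² W_ε`). Tasaki (2020) §2.1. [folklore] -/
theorem sq_re_gsf_pairField_le_windowOp (ε : ℝ)
    {A : Matrix (Finset (Orb (FermionTorus 2 L))) (Finset (Orb (FermionTorus 2 L))) ℂ}
    (hA : A.IsHermitian) :
    (A.groundStateFunctional (pairField dWaveFormFactor L)).re ^ 2 ≤
      (L : ℝ) ^ 2 * (A.groundStateFunctional (∑ m : TorusSite 2 L, if momentumNormSq L m ≤ ε ^ 2 then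
        ((L : ℂ) ^ 2)⁻¹ • ((pairFieldAt dWaveFormFactor L m)ᴴ * pairFieldAt dWaveFormFactor L m)
        else 0)).re := by
  have h1 := sq_re_groundStateFunctional_le hA (pairField dWaveFormFactor L)
  have hW : ((((L : ℝ) ^ 2 : ℝ) : ℂ) • ∑ m : TorusSite 2 L, if momentumNormSq L m ≤ ε ^ 2 then
      ((L : ℂ) ^ 2)⁻¹ • ((pairFieldAt dWaveFormFactor L m)ᴴ * pairFieldAt dWaveFormFactor L m)
      else 0).IsHermitian :=
    IsHermitian.smul (isHermitian_windowOp L ε)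
      (by rw [isSelfAdjoint_iff, Complex.star_def, Complex.conj_ofReal])
  have h2 : (A.groundStateFunctional ((pairField dWaveFormFactor L)ᴴ * pairField dWaveFormFactor L)).re ≤
      (A.groundStateFunctional ((((L : ℝ) ^ 2 : ℝ) : ℂ) • ∑ m : TorusSite 2 L,
        if momentumNormSq L m ≤ ε ^ 2 then
          ((L : ℂ) ^ 2)⁻¹ • ((pairFieldAt dWaveFormFactor L m)ᴴ * pairFieldAt dWaveFormFactor L m)
        else 0)).re := by
    refine re_groundStateFunctional_mono (isHermitian_conjTranspose_mul_self _) hW fun x => ?_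
    rw [smul_mulVec, dotProduct_smul, smul_eq_mul, Complex.re_ofReal_mul]
    exact re_expect_pairField_le_sq_mul_windowOp L ε x
  rw [LinearMap.map_smul, smul_eq_mul, Complex.re_ofReal_mul] at h2
  exact h1.trans h2

/-- `Σ_{e ∈ {0, ±e₁, ±e₂}} |d(e)/√2| = 4/√2 ≤ 3`. [folklore] -/
theorem sum_abs_dWaveFormFactor_div_sqrt_two_le_three :
    ∑ e ∈ insert (0 : Site 2) unitSteps, |dWaveFormFactor e / Real.sqrt 2| ≤ 3 := by
  -- adapted from Cruxes/CwSsbToEvenTorusLRO/Drefute-griffiths-block-slope-StubProofs.lean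
  rw [Finset.sum_insert zero_not_mem_unitSteps, dWaveFormFactor_zero, zero_div, abs_zero, zero_add,
    sum_unitSteps, dWaveFormFactor_unitStep, dWaveFormFactor_unitStep, dWaveFormFactor_neg_unitStep,
    dWaveFormFactor_neg_unitStep]
  simp only [Fin.isValue, if_true, one_ne_zero, if_false]
  have hs : 0 < Real.sqrt 2 := Real.sqrt_pos.2 (by norm_num)
  have h1 : |(1 : ℝ) / Real.sqrt 2| = 1 / Real.sqrt 2 := abs_of_nonneg (by positivity)
  have h2 : |(-1 : ℝ) / Real.sqrt 2| = 1 / Real.sqrt 2 := by rw [neg_div, abs_neg, h1]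
  rw [h1, h2]
  have hsq := Real.sq_sqrt (show (0 : ℝ) ≤ 2 by norm_num)
  have : 1 / Real.sqrt 2 ≤ 3 / 4 := by
    rw [div_le_div_iff₀ hs (by norm_num : (0:ℝ) < 4)]
    nlinarith
  linarith

/-- **The `d`-wave source is `O(L²)` in operator norm**: `‖h (Δ_d + Δ_dᴴ)‖ ≤ 12 h L²` for `h ≥ 0`
(`‖Δ_d‖ ≤ 2 (Σ_e |d(e)/√2|) L² ≤ 6 L²`, `norm_pairField_le`). [folklore] -/
theorem norm_source_le {h : ℝ} (hh : 0 ≤ h) :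
    ‖(h : ℂ) • (pairField dWaveFormFactor L + (pairField dWaveFormFactor L)ᴴ)‖ ≤ 12 * h * (L : ℝ) ^ 2 := by
  have hP := norm_pairField_le dWaveFormFactor L
  have hP' : ‖pairField dWaveFormFactor L‖ ≤ 6 * (L : ℝ) ^ 2 := by
    refine hP.trans ?_
    have hL : (0 : ℝ) ≤ (L : ℝ) ^ 2 := by positivity
    nlinarith [sum_abs_dWaveFormFactor_div_sqrt_two_le_three, hL]
  calc ‖(h : ℂ) • (pairField dWaveFormFactor L + (pairField dWaveFormFactor L)ᴴ)‖
      ≤ ‖(h : ℂ)‖ * (‖pairField dWaveFormFactor L‖ + ‖(pairField dWaveFormFactor L)ᴴ‖) := by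
        rw [norm_smul]
        exact mul_le_mul_of_nonneg_left (norm_add_le _ _) (norm_nonneg _)
    _ = h * (2 * ‖pairField dWaveFormFactor L‖) := by
        rw [l2_opNorm_conjTranspose, Complex.norm_real, Real.norm_eq_abs, abs_of_nonneg hh]
        ring
    _ ≤ h * (2 * (6 * (L : ℝ) ^ 2)) := by gcongr
    _ = 12 * h * (L : ℝ) ^ 2 := by ring

end Window

/-! ### 4. The card's first lemma: `stub_sourcedChord` -/

section Chord

/-- **`stub_sourcedChord` (first lemma of idea `sourced-penalty-trial-state`).** For the grand-canonical Hubbard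
torus `A = H_U − μN` (`hubbardTorusWith 2 L 1 U μ`), every window radius `ε`, penalty `λ ≥ 0` and source
`h ≥ 0`, let `ω` be the tracial ground state of the penalised, sourced Hamiltonian
`A + λ W_ε − h (Δ_d + Δ_dᴴ)` and `m := Re ω(Δ_d)/L²` its `d`-wave pair density. Then
`λ L² m² − 24 h L² ≤ E₀(A + λ W_ε) − E₀(A)`: the window chord of the UNSOURCED grand-canonical problem is
bounded below by the penalty times the SQUARE of a Koma–Tasaki order parameter, up to the source pay-back
`2‖h(Δ_d + Δ_dᴴ)‖ ≤ 24 h L²` (`penalisedSourceChord` + `sq_re_gsf_pairField_le_windowOp` + `norm_source_le`).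
Koma–Tasaki, J. Stat. Phys. 76 (1994) 745, §1; Tasaki (2020) §2.1. [folklore] -/
theorem stub_sourcedChord : ∀ (L : ℕ) [NeZero L] (U μ ε lam h : ℝ), 0 ≤ lam → 0 ≤ h →
    lam * (L : ℝ) ^ 2 *
          (((hubbardTorusWith 2 L 1 U μ + (lam : ℂ) • (∑ m : TorusSite 2 L, if momentumNormSq L m ≤ ε ^ 2 then
                ((L : ℂ) ^ 2)⁻¹ • ((pairFieldAt dWaveFormFactor L m)ᴴ * pairFieldAt dWaveFormFactor L m)
                else 0) -
              (h : ℂ) • (pairField dWaveFormFactor L + (pairField dWaveFormFactor L)ᴴ)).groundStateFunctional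
            (pairField dWaveFormFactor L)).re / (L : ℝ) ^ 2) ^ 2 -
        24 * h * (L : ℝ) ^ 2 ≤
      (hubbardTorusWith 2 L 1 U μ + (lam : ℂ) • ∑ m : TorusSite 2 L, if momentumNormSq L m ≤ ε ^ 2 then
          ((L : ℂ) ^ 2)⁻¹ • ((pairFieldAt dWaveFormFactor L m)ᴴ * pairFieldAt dWaveFormFactor L m)
          else 0).groundEnergy -
        (hubbardTorusWith 2 L 1 U μ).groundEnergy := by
  intro L _ U μ ε lam h hlam hh
  have hA := isHermitian_hubbardTorusWith L 1 U μ
  have hW := isHermitian_windowOp L ε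
  have hS : ((h : ℂ) • (pairField dWaveFormFactor L + (pairField dWaveFormFactor L)ᴴ)).IsHermitian :=
    IsHermitian.smul (isHermitian_pairField_add_conjTranspose L)
      (by rw [isSelfAdjoint_iff, Complex.star_def, Complex.conj_ofReal])
  have hK : (hubbardTorusWith 2 L 1 U μ + (lam : ℂ) • (∑ m : TorusSite 2 L, if momentumNormSq L m ≤ ε ^ 2 then
      ((L : ℂ) ^ 2)⁻¹ • ((pairFieldAt dWaveFormFactor L m)ᴴ * pairFieldAt dWaveFormFactor L m) else 0) -
      (h : ℂ) • (pairField dWaveFormFactor L + (pairField dWaveFormFactor L)ᴴ)).IsHermitian :=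
    (isHermitian_add_real_smul hA hW lam).sub hS
  have hchord := penalisedSourceChord hA hW hS lam
  have hdom := sq_re_gsf_pairField_le_windowOp L ε hK
  have hsrc := norm_source_le L hh
  have hL : (0 : ℝ) < (L : ℝ) ^ 2 := cast_sq_pos_of_neZero L
  -- abbreviate the two real numbers
  set mre := ((hubbardTorusWith 2 L 1 U μ + (lam : ℂ) • (∑ m : TorusSite 2 L, if momentumNormSq L m ≤ ε ^ 2 then
      ((L : ℂ) ^ 2)⁻¹ • ((pairFieldAt dWaveFormFactor L m)ᴴ * pairFieldAt dWaveFormFactor L m) else 0) -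
      (h : ℂ) • (pairField dWaveFormFactor L + (pairField dWaveFormFactor L)ᴴ)).groundStateFunctional
        (pairField dWaveFormFactor L)).re with hmre
  set wre := ((hubbardTorusWith 2 L 1 U μ + (lam : ℂ) • (∑ m : TorusSite 2 L, if momentumNormSq L m ≤ ε ^ 2 then
      ((L : ℂ) ^ 2)⁻¹ • ((pairFieldAt dWaveFormFactor L m)ᴴ * pairFieldAt dWaveFormFactor L m) else 0) -
      (h : ℂ) • (pairField dWaveFormFactor L + (pairField dWaveFormFactor L)ᴴ)).groundStateFunctional
        (∑ m : TorusSite 2 L, if momentumNormSq L m ≤ ε ^ 2 then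
          ((L : ℂ) ^ 2)⁻¹ • ((pairFieldAt dWaveFormFactor L m)ᴴ * pairFieldAt dWaveFormFactor L m) else 0)).re
    with hwre
  have hsq : lam * (L : ℝ) ^ 2 * (mre / (L : ℝ) ^ 2) ^ 2 ≤ lam * wre := by
    have e : (L : ℝ) ^ 2 * (mre / (L : ℝ) ^ 2) ^ 2 = mre ^ 2 / (L : ℝ) ^ 2 := by
      field_simp
    rw [mul_assoc, e]
    refine mul_le_mul_of_nonneg_left ?_ hlam
    rw [div_le_iff₀ hL]
    linarith
  linarith

end Chord

end Summit.HubbardSuperconductivity.HubbardSuperconductivity.Theorems.NoNormalLimitState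

end
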